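import Mathlib.Algebra.BigOperators.Ring.Finset
import Mathlib.Algebra.Order.BigOperators.Group.Finset
import Literature.Computability.Complexity.DiscreteTomography
import HarnessLib

/-!
# Discrete tomography: complete pyramids, `β̄`/`β` on layers, and the list-level reduction of
# Fischer–Ikenmeyer 2020, Lemma 5 (with Lemmas 6–7), for both cones

Combinatorial half of the discharge of the named fact
`Literature.Computability.Complexity.Tomography.FischerIkenmeyer2020_lemma5`
(`DiscreteTomography.lean`; N. Fischer, C. Ikenmeyer, *The computational complexity of plethysm
coefficients*, Comput. Complexity 29 (2020), Lemma 5: "There exists a parsimonious polynomial-time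
reduction from SYMMETRIC-2D-X-RAY to PROMISE-SYMMETRIC-3D-X-RAY. Moreover, … from
SKEW-SYMMETRIC-2D-X-RAY to PROMISE-SKEW-SYMMETRIC-3D-X-RAY"). Everything is done ONCE for an
arbitrary decidable region `K ⊆ ℕ³` and then read off for `K = C̄` (closed cone, symmetric problems)
and `K = C` (open cone, skew-symmetric problems); the specialisations are definitional
(`xiK_closed`, `betaK_closed`, `symTwoDXRaySet_eq`, … are `rfl`).

* `layer K i = K ∩ G_i`, `xiK K i = |layer K i|` (`= ξ̄(i)`, `ξ(i)`), `pyrBelow K r = K ∩ {x+y+z < r}`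
  — the complete pyramid `P̄_{r-1}` / `P_{r-1}` of FI §6 (before Lemma 6), with `pyrBelow K 0 = ∅`
  (`pyrBelow_closed_succ : pyrBelow C̄ (r+1) = completePyramidBar r`); `iotaK`, `betaK` (`= ῑ, β̄` /
  `ι, β`); `card_pyrBelow`, `coordSumSet_pyrBelow`; `iotaK_eq_of_layer` (`ῑ(n) = r` on layer `r`) and
  **`betaK_card_pyrBelow_add`**: `β̄(|P̄_{r-1}| + m) = B(P̄_{r-1}) + r m` for `m ≤ ξ̄(r)` (the
  computation "β̄ is the piecewise linear interpolation of `B(P̄_r)`", FI §6 before Lemma 6, used in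
  the proof of Lemma 7).
* Double counting for marginals of a point set in the box `[0, L)³`: `Σ_i S_i(P) = 3|P|`
  (`sum_sumMarginal`), `Σ_i i·S_i(P) = B(P)` (`sum_mul_sumMarginal`), and the marginals as iterated
  indicator sums (`xMarginal_eq_sum_sum`, …, `sumMarginal_pyrBelow_eq_sum_sum`: the formula the
  reduction MACHINE evaluates, `DiscreteTomographyProofs.lean`).
* The list-level reduction of Lemma 5: `Good l` (the test "`|λ̂| = 3n` and `B(λ̂) = r n`", `r + 1 =`
  length, plus `λ̂ ≠ []`), `addPyr K l = S(pyrBelow K r) + l` (Lemma 7's `λ := S(P̄_{r-1}) + λ̂`),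
  `badList = [1]` (violates both promises), `reduceList K l`.
* `symSetK K`, `promiseSetK K`: the yes-instance sets of (SKEW-)SYMMETRIC-2D-X-RAY and of
  PROMISE-(SKEW-)SYMMETRIC-3D-X-RAY for the region `K` (`rfl`-equal to the four sets of
  `DiscreteTomography.lean`), and **`mem_symSetK_iff_reduceList_mem`**:
  `l ∈ symSetK K ↔ reduceList K l ∈ promiseSetK K`. Direction `→` is Lemma 7 (`P := P̄_{r-1} ∪ P̂`,
  promise by `betaK_card_pyrBelow_add` since `|P̂| ≤ ξ(r)`); direction `←` is proved by a direct
  exchange count replacing the appeal to Lemma 6: for `P ⊆ K` with `S(P) = S(P̄_{r-1}) + λ̂`,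
  `|λ̂| = 3n`, `B(λ̂) = rn`, the sets `M := P̄_{r-1} ∖ P` and `D := P ∖ P̄_{r-1}` satisfy `|D| = |M| + n`,
  `B(D) = B(M) + rn`, `B(D) ≥ r|D|`, `B(M) ≤ (r-1)|M|`, whence `M = ∅`, `P̄_{r-1} ⊆ P` and
  `P̂ := D ⊆ G_r` solves the 2D instance (`mem_of_addPyr_mem`).

Remark on the printed Lemma 7 ("`B(λ) = β̄(|P̄_{r-1}| + n)`"): this needs `n ≤ ξ̄(r)`; for `n > ξ̄(r)`
the image violates the promise — a non-member in the tree's "promise ∧ yes" rendering of Problem 10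
— while the source instance is a no-instance (`|G_r ∩ C̄| = ξ̄(r) < n`), so the decision-form
reduction (the content of `FischerIkenmeyer2020_lemma5`) is unaffected.

## References

* [FischerIkenmeyer2020] N. Fischer, C. Ikenmeyer, *The computational complexity of plethysm
  coefficients*, Comput. Complexity 29 (2020) 8, arXiv:2002.00788 (held: `arxiv-2002.00788`,
  pp. 9–12 of the text), §5 (before Lemma 2: `ξ̄, ῑ, β̄`), §6 (Problems 7, 10; Lemmas 5, 6, 7 and the
  proof of Lemma 5).
-/

namespace Literature.Computability.Complexity

open _root_.Computability

namespace Tomography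

variable (K : Point → Prop) [DecidablePred K]

/-! ### Layers, the pyramid below a layer, `ξ`, `ι`, `β` for a region `K` -/

/-- `layer K i = K ∩ G_i`: the points of `K` with coordinate sum `i` (all of them lie in the box
`[0, i]³`). [cite: FischerIkenmeyer2020, §5 (ξ̄(i), ξ(i)) and §6 (G_r)] -/
def layer (i : ℕ) : Finset Point := (box (i + 1)).filter fun p => K p ∧ coordSum p = i

/-- `ξ_K(i) = |layer K i|` (`ξ̄(i)` for `K = C̄`, `ξ(i)` for `K = C`).
[cite: FischerIkenmeyer2020, §5 (before Lemma 2)] -/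
def xiK (i : ℕ) : ℕ := (layer K i).card

/-- `pyrBelow K r = K ∩ {x + y + z < r}`: the complete pyramid `P̄_{r-1}` (`K = C̄`) / `P_{r-1}`
(`K = C`) strictly below the layer `G_r`; empty for `r = 0`.
[cite: FischerIkenmeyer2020, §6 (before Lemma 6: complete pyramids)] -/
def pyrBelow (r : ℕ) : Finset Point := (box r).filter fun p => K p ∧ coordSum p < r

/-- `ι_K(n) = min {ι : Σ_{i ≤ ι} ξ_K(i) ≥ n}`. [cite: FischerIkenmeyer2020, §5 (before Lemma 2)] -/
noncomputable def iotaK (n : ℕ) : ℕ := sInf {ι | n ≤ ∑ i ∈ Finset.range (ι + 1), xiK K i}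

/-- `β_K(n) = Σ_{i=1}^{n} ι_K(i)`. [cite: FischerIkenmeyer2020, §5 (before Lemma 2)] -/
noncomputable def betaK (n : ℕ) : ℕ := ∑ i ∈ Finset.Icc 1 n, iotaK K i

/-- `ξ_{C̄} = ξ̄` (definitionally). [cite: FischerIkenmeyer2020, §5 (before Lemma 2)] -/
theorem xiK_closed : xiK IsInClosedCone = xiBar := rfl

/-- `ξ_C = ξ` (definitionally). [cite: FischerIkenmeyer2020, §5 (before Lemma 2)] -/
theorem xiK_open : xiK IsInOpenCone = xi := rfl

/-- `ι_{C̄} = ῑ` (definitionally). [cite: FischerIkenmeyer2020, §5 (before Lemma 2)] -/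
theorem iotaK_closed : iotaK IsInClosedCone = iotaBar := rfl

/-- `ι_C = ι` (definitionally). [cite: FischerIkenmeyer2020, §5 (before Lemma 2)] -/
theorem iotaK_open : iotaK IsInOpenCone = iota := rfl

/-- `β_{C̄} = β̄` (definitionally). [cite: FischerIkenmeyer2020, §5 (before Lemma 2)] -/
theorem betaK_closed : betaK IsInClosedCone = betaBar := rfl

/-- `β_C = β` (definitionally). [cite: FischerIkenmeyer2020, §5 (before Lemma 2)] -/
theorem betaK_open : betaK IsInOpenCone = beta := rfl

variable {K}

/-- Membership in a layer (the box condition is automatic). [folklore] -/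
theorem mem_layer {i : ℕ} {p : Point} : p ∈ layer K i ↔ K p ∧ coordSum p = i := by
  simp only [layer, Finset.mem_filter, mem_box, and_iff_right_iff_imp]
  rintro ⟨-, h⟩
  unfold coordSum at h
  omega

/-- Membership in the pyramid below layer `r` (the box condition is automatic). [folklore] -/
theorem mem_pyrBelow {r : ℕ} {p : Point} : p ∈ pyrBelow K r ↔ K p ∧ coordSum p < r := by
  simp only [pyrBelow, Finset.mem_filter, mem_box, and_iff_right_iff_imp]
  rintro ⟨-, h⟩
  unfold coordSum at h
  omega

/-- The pyramid below layer `r` lies in the box `[0, r)³`. [folklore] -/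
theorem pyrBelow_subset_box (r : ℕ) : pyrBelow K r ⊆ box r := Finset.filter_subset _ _

/-- Boxes are monotone. [folklore] -/
theorem box_mono {L L' : ℕ} (h : L ≤ L') : box L ⊆ box L' := fun p hp => by
  have := mem_box.1 hp
  exact mem_box.2 ⟨by omega, by omega, by omega⟩

variable (K)

/-- `pyrBelow K 0 = ∅`. [folklore] -/
theorem pyrBelow_zero : pyrBelow K 0 = ∅ := by
  ext p
  simp [mem_pyrBelow]

/-- `pyrBelow K (r + 1) = pyrBelow K r ∪ layer K r`. [cite: FischerIkenmeyer2020, §6 (before Lemma 6)] -/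
theorem pyrBelow_succ (r : ℕ) : pyrBelow K (r + 1) = pyrBelow K r ∪ layer K r := by
  ext p
  simp only [mem_pyrBelow, Finset.mem_union, mem_layer, ← and_or_left, Nat.lt_succ_iff_lt_or_eq]

/-- The pyramid below layer `r` is disjoint from layer `r`. [folklore] -/
theorem disjoint_pyrBelow_layer (r : ℕ) : Disjoint (pyrBelow K r) (layer K r) := by
  rw [Finset.disjoint_left]
  intro p hp hq
  rw [mem_pyrBelow] at hp
  rw [mem_layer] at hq
  omega

/-- `|pyrBelow K r| = Σ_{i < r} ξ_K(i)`. [cite: FischerIkenmeyer2020, §6 (before Lemma 6)] -/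
theorem card_pyrBelow (r : ℕ) : (pyrBelow K r).card = ∑ i ∈ Finset.range r, xiK K i := by
  induction r with
  | zero => simp [pyrBelow_zero]
  | succ r ih =>
    rw [pyrBelow_succ, Finset.card_union_of_disjoint (disjoint_pyrBelow_layer K r), ih,
      Finset.sum_range_succ, xiK]

/-- `B(pyrBelow K r) = Σ_{i < r} i · ξ_K(i)`. [cite: FischerIkenmeyer2020, §6 (before Lemma 6: "β̄(|P̄_r|) = B(P̄_r)")] -/
theorem coordSumSet_pyrBelow (r : ℕ) :
    coordSumSet (pyrBelow K r) = ∑ i ∈ Finset.range r, i * xiK K i := by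
  induction r with
  | zero => simp [pyrBelow_zero, coordSumSet]
  | succ r ih =>
    rw [coordSumSet, pyrBelow_succ, Finset.sum_union (disjoint_pyrBelow_layer K r), ← coordSumSet, ih,
      Finset.sum_range_succ, xiK, Finset.sum_const_nat (m := r) fun p hp => (mem_layer.1 hp).2, Nat.mul_comm]

/-- `pyrBelow C̄ (r + 1)` is the complete pyramid `P̄_r` of `DiscreteTomography.lean`.
[cite: FischerIkenmeyer2020, §6 (before Lemma 6)] -/
theorem pyrBelow_closed_succ (r : ℕ) : pyrBelow IsInClosedCone (r + 1) = completePyramidBar r := by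
  ext p
  rw [mem_pyrBelow, completePyramidBar, Finset.mem_filter, mem_box, Nat.lt_succ_iff]
  unfold coordSum
  exact ⟨fun h => ⟨⟨by omega, by omega, by omega⟩, h.1, h.2⟩, fun h => ⟨h.2.1, h.2.2⟩⟩

/-- `pyrBelow C (r + 1)` is the complete pyramid `P_r` of `DiscreteTomography.lean`.
[cite: FischerIkenmeyer2020, §6 (before Lemma 6)] -/
theorem pyrBelow_open_succ (r : ℕ) : pyrBelow IsInOpenCone (r + 1) = completePyramid r := by
  ext p
  rw [mem_pyrBelow, completePyramid, Finset.mem_filter, mem_box, Nat.lt_succ_iff]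
  unfold coordSum
  exact ⟨fun h => ⟨⟨by omega, by omega, by omega⟩, h.1, h.2⟩, fun h => ⟨h.2.1, h.2.2⟩⟩

/-- **`ι_K` on layer `r`**: if `|pyrBelow K r| < n ≤ |pyrBelow K (r+1)|` then `ι_K(n) = r` (the `n`-th
point of `K` in order of coordinate sum lies on `G_r`). [cite: FischerIkenmeyer2020, §5 (before Lemma 2) and §6 (before Lemma 6)] -/
theorem iotaK_eq_of_layer {n r : ℕ} (h1 : (pyrBelow K r).card < n) (h2 : n ≤ (pyrBelow K (r + 1)).card) :
    iotaK K n = r := by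
  rw [card_pyrBelow] at h1 h2
  unfold iotaK
  refine le_antisymm (Nat.sInf_le h2) (le_csInf ⟨r, h2⟩ fun ι hι => ?_)
  by_contra hlt
  have hle : ι + 1 ≤ r := by omega
  have : ∑ i ∈ Finset.range (ι + 1), xiK K i ≤ ∑ i ∈ Finset.range r, xiK K i :=
    Finset.sum_le_sum_of_subset (Finset.range_subset_range.2 hle)
  exact absurd (le_trans hι this) (not_le.2 h1)

/-- `β_K` as a sum over `range`. [folklore] -/
theorem betaK_eq_sum_range (n : ℕ) : betaK K n = ∑ i ∈ Finset.range n, iotaK K (i + 1) := by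
  rw [betaK, ← Finset.Ico_add_one_right_eq_Icc, Finset.sum_Ico_eq_sum_range, Nat.add_sub_cancel]
  exact Finset.sum_congr rfl fun i _ => by rw [Nat.add_comm]

/-- **`β̄` interpolates `B(P̄_r)` linearly** (FI §6, before Lemma 6: "`β̄(|P̄_r|) = B(P̄_r)` … `β̄(n)` is
the piecewise linear interpolation between these values"): for `m ≤ ξ_K(r)`,
`β_K(|pyrBelow K r| + m) = B(pyrBelow K r) + r·m`. [cite: FischerIkenmeyer2020, §6 (before Lemma 6) and Lemma 7 (proof)] -/
theorem betaK_card_pyrBelow_add {r m : ℕ} (hm : m ≤ xiK K r) :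
    betaK K ((pyrBelow K r).card + m) = coordSumSet (pyrBelow K r) + r * m := by
  induction r generalizing m with
  | zero =>
    rw [pyrBelow_zero, Finset.card_empty, Nat.zero_add, Nat.zero_mul, betaK_eq_sum_range]
    simp only [coordSumSet, Finset.sum_empty, Nat.add_zero]
    refine Finset.sum_eq_zero fun i hi => iotaK_eq_of_layer K (r := 0) (by simp [pyrBelow_zero]) ?_
    rw [card_pyrBelow, Finset.sum_range_one]
    have := Finset.mem_range.1 hi
    omega
  | succ r ih =>
    have hcard : (pyrBelow K (r + 1)).card = (pyrBelow K r).card + xiK K r := by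
      rw [card_pyrBelow, card_pyrBelow, Finset.sum_range_succ]
    have hB : coordSumSet (pyrBelow K (r + 1)) = coordSumSet (pyrBelow K r) + r * xiK K r := by
      rw [coordSumSet_pyrBelow, coordSumSet_pyrBelow, Finset.sum_range_succ]
    rw [betaK_eq_sum_range, Finset.sum_range_add, ← betaK_eq_sum_range, hcard, ih le_rfl, hB]
    suffices h : ∑ x ∈ Finset.range m, iotaK K ((pyrBelow K r).card + xiK K r + x + 1) = (r + 1) * m by
      rw [h]
    rw [show (r + 1) * m = ∑ _x ∈ Finset.range m, (r + 1) by simp [Nat.mul_comm]]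
    refine Finset.sum_congr rfl fun x hx => iotaK_eq_of_layer K (r := r + 1) (by omega) ?_
    have hx := Finset.mem_range.1 hx
    have hcard' : (pyrBelow K (r + 1 + 1)).card = (pyrBelow K (r + 1)).card + xiK K (r + 1) := by
      rw [card_pyrBelow, card_pyrBelow K (r + 1), Finset.sum_range_succ]
    omega

variable {K}

/-! ### Double counting for marginals -/

/-- `Σ_{i < L} X_i(P) = |P|` for `P ⊆ [0, L)³`. [folklore] -/
theorem sum_xMarginal {P : Finset Point} {L : ℕ} (hP : P ⊆ box L) :
    ∑ i ∈ Finset.range L, xMarginal P i = P.card := by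
  unfold xMarginal
  exact (Finset.card_eq_sum_card_fiberwise (s := P) (t := Finset.range L) (f := fun p : Point => p.1)
    fun p hp => Finset.mem_coe.2 (Finset.mem_range.2 (mem_box.1 (hP hp)).1)).symm

/-- `Σ_{i < L} Y_i(P) = |P|` for `P ⊆ [0, L)³`. [folklore] -/
theorem sum_yMarginal {P : Finset Point} {L : ℕ} (hP : P ⊆ box L) :
    ∑ i ∈ Finset.range L, yMarginal P i = P.card := by
  unfold yMarginal
  exact (Finset.card_eq_sum_card_fiberwise (s := P) (t := Finset.range L) (f := fun p : Point => p.2.1)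
    fun p hp => Finset.mem_coe.2 (Finset.mem_range.2 (mem_box.1 (hP hp)).2.1)).symm

/-- `Σ_{i < L} Z_i(P) = |P|` for `P ⊆ [0, L)³`. [folklore] -/
theorem sum_zMarginal {P : Finset Point} {L : ℕ} (hP : P ⊆ box L) :
    ∑ i ∈ Finset.range L, zMarginal P i = P.card := by
  unfold zMarginal
  exact (Finset.card_eq_sum_card_fiberwise (s := P) (t := Finset.range L) (f := fun p : Point => p.2.2)
    fun p hp => Finset.mem_coe.2 (Finset.mem_range.2 (mem_box.1 (hP hp)).2.2)).symm

/-- **`Σ_i S_i(P) = 3|P|`** ("|S(P)| = 3|P|", FI §5) for `P ⊆ [0, L)³`.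
[cite: FischerIkenmeyer2020, §5 ("Note that |S(P)| = 3|P|")] -/
theorem sum_sumMarginal {P : Finset Point} {L : ℕ} (hP : P ⊆ box L) :
    ∑ i ∈ Finset.range L, sumMarginal P i = 3 * P.card := by
  simp only [sumMarginal, Finset.sum_add_distrib, sum_xMarginal hP, sum_yMarginal hP, sum_zMarginal hP]
  ring

/-- A weighted fibre count: `Σ_{i<L} i · |{p ∈ P : g p = i}| = Σ_{p ∈ P} g p` when `g < L` on `P`. [folklore] -/
theorem sum_mul_card_fiber {P : Finset Point} {L : ℕ} (g : Point → ℕ) (hg : ∀ p ∈ P, g p < L) :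
    ∑ i ∈ Finset.range L, i * (P.filter fun p => g p = i).card = ∑ p ∈ P, g p := by
  rw [← Finset.sum_fiberwise_of_maps_to (g := g) (t := Finset.range L)
    (fun p hp => Finset.mem_range.2 (hg p hp)) g]
  refine Finset.sum_congr rfl fun i _ => ?_
  rw [Finset.card_eq_sum_ones, Finset.mul_sum]
  exact Finset.sum_congr rfl fun p hp => by rw [(Finset.mem_filter.1 hp).2, Nat.mul_one]

/-- **`Σ_i i · S_i(P) = B(P)`** ("B(P) := B(S(P)) … is the same as the sum over all coordinates", FI §5)
for `P ⊆ [0, L)³`. [cite: FischerIkenmeyer2020, §5 (before Lemma 2)] -/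
theorem sum_mul_sumMarginal {P : Finset Point} {L : ℕ} (hP : P ⊆ box L) :
    ∑ i ∈ Finset.range L, i * sumMarginal P i = coordSumSet P := by
  simp only [sumMarginal, Nat.mul_add, Finset.sum_add_distrib, xMarginal, yMarginal, zMarginal]
  rw [sum_mul_card_fiber (fun p => p.1) fun p hp => (mem_box.1 (hP hp)).1,
    sum_mul_card_fiber (fun p => p.2.1) fun p hp => (mem_box.1 (hP hp)).2.1,
    sum_mul_card_fiber (fun p => p.2.2) fun p hp => (mem_box.1 (hP hp)).2.2,
    coordSumSet, ← Finset.sum_add_distrib, ← Finset.sum_add_distrib]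
  rfl

/-- The `X`-marginal of a disjoint union. [folklore] -/
theorem xMarginal_union {A B : Finset Point} (h : Disjoint A B) (i : ℕ) :
    xMarginal (A ∪ B) i = xMarginal A i + xMarginal B i := by
  unfold xMarginal
  rw [Finset.filter_union, Finset.card_union_of_disjoint (Finset.disjoint_filter_filter h)]

/-- The `Y`-marginal of a disjoint union. [folklore] -/
theorem yMarginal_union {A B : Finset Point} (h : Disjoint A B) (i : ℕ) :
    yMarginal (A ∪ B) i = yMarginal A i + yMarginal B i := by
  unfold yMarginal
  rw [Finset.filter_union, Finset.card_union_of_disjoint (Finset.disjoint_filter_filter h)]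

/-- The `Z`-marginal of a disjoint union. [folklore] -/
theorem zMarginal_union {A B : Finset Point} (h : Disjoint A B) (i : ℕ) :
    zMarginal (A ∪ B) i = zMarginal A i + zMarginal B i := by
  unfold zMarginal
  rw [Finset.filter_union, Finset.card_union_of_disjoint (Finset.disjoint_filter_filter h)]

/-- **The sum-marginal is additive over disjoint unions** (`S(P̄_{r-1} ∪ P̂) = S(P̄_{r-1}) + S(P̂)`,
proof of Lemma 7). [cite: FischerIkenmeyer2020, Lemma 7 (proof)] -/
theorem sumMarginal_union {A B : Finset Point} (h : Disjoint A B) :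
    sumMarginal (A ∪ B) = sumMarginal A + sumMarginal B := by
  funext i
  simp only [sumMarginal, Pi.add_apply, xMarginal_union h, yMarginal_union h, zMarginal_union h]
  ring

/-- The sum of a composition is the sum of its entries `λ_0, …, λ_r`. [folklore] -/
theorem sum_eq_sum_range_listFn (l : List ℕ) : l.sum = ∑ i ∈ Finset.range l.length, listFn l i := by
  induction l with
  | nil => simp
  | cons a l ih =>
    rw [List.sum_cons, List.length_cons, Finset.sum_range_succ', ih]
    simp [listFn, Nat.add_comm]

/-! ### Marginals as iterated indicator sums (the formula evaluated by the reduction machine) -/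

/-- `X_a(P) = Σ_{y<L} Σ_{z<L} [(a,y,z) ∈ P]` for `P ⊆ [0, L)³`. [folklore] -/
theorem xMarginal_eq_sum_sum {P : Finset Point} {L : ℕ} (hP : P ⊆ box L) (a : ℕ) :
    xMarginal P a = ∑ y ∈ Finset.range L, ∑ z ∈ Finset.range L, if (a, y, z) ∈ P then 1 else 0 := by
  rw [← Finset.sum_product (s := Finset.range L) (t := Finset.range L)
    (f := fun q : ℕ × ℕ => if ((a, q) : Point) ∈ P then 1 else 0), ← Finset.card_filter]
  unfold xMarginal
  refine Finset.card_nbij' (fun p => p.2) (fun q => (a, q)) (fun p hp => ?_) (fun q hq => ?_)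
    (fun p hp => ?_) (fun q _ => rfl)
  · obtain ⟨hp, h1⟩ := Finset.mem_filter.1 (Finset.mem_coe.1 hp)
    have hb := mem_box.1 (hP hp)
    refine Finset.mem_coe.2 (Finset.mem_filter.2
      ⟨Finset.mem_product.2 ⟨Finset.mem_range.2 hb.2.1, Finset.mem_range.2 hb.2.2⟩, ?_⟩)
    rw [← h1]
    exact hp
  · obtain ⟨-, hq⟩ := Finset.mem_filter.1 (Finset.mem_coe.1 hq)
    exact Finset.mem_coe.2 (Finset.mem_filter.2 ⟨hq, rfl⟩)
  · obtain ⟨-, h1⟩ := Finset.mem_filter.1 (Finset.mem_coe.1 hp)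
    exact Prod.ext h1.symm rfl

/-- `Y_a(P) = Σ_{x<L} Σ_{z<L} [(x,a,z) ∈ P]` for `P ⊆ [0, L)³`. [folklore] -/
theorem yMarginal_eq_sum_sum {P : Finset Point} {L : ℕ} (hP : P ⊆ box L) (a : ℕ) :
    yMarginal P a = ∑ x ∈ Finset.range L, ∑ z ∈ Finset.range L, if (x, a, z) ∈ P then 1 else 0 := by
  rw [← Finset.sum_product (s := Finset.range L) (t := Finset.range L)
    (f := fun q : ℕ × ℕ => if ((q.1, a, q.2) : Point) ∈ P then 1 else 0), ← Finset.card_filter]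
  unfold yMarginal
  refine Finset.card_nbij' (fun p => (p.1, p.2.2)) (fun q => (q.1, a, q.2)) (fun p hp => ?_)
    (fun q hq => ?_) (fun p hp => ?_) (fun q _ => rfl)
  · obtain ⟨hp, h1⟩ := Finset.mem_filter.1 (Finset.mem_coe.1 hp)
    have hb := mem_box.1 (hP hp)
    refine Finset.mem_coe.2 (Finset.mem_filter.2
      ⟨Finset.mem_product.2 ⟨Finset.mem_range.2 hb.1, Finset.mem_range.2 hb.2.2⟩, ?_⟩)
    rw [← h1]
    exact hp
  · obtain ⟨-, hq⟩ := Finset.mem_filter.1 (Finset.mem_coe.1 hq)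
    exact Finset.mem_coe.2 (Finset.mem_filter.2 ⟨hq, rfl⟩)
  · obtain ⟨-, h1⟩ := Finset.mem_filter.1 (Finset.mem_coe.1 hp)
    exact Prod.ext rfl (Prod.ext h1.symm rfl)

/-- `Z_a(P) = Σ_{x<L} Σ_{y<L} [(x,y,a) ∈ P]` for `P ⊆ [0, L)³`. [folklore] -/
theorem zMarginal_eq_sum_sum {P : Finset Point} {L : ℕ} (hP : P ⊆ box L) (a : ℕ) :
    zMarginal P a = ∑ x ∈ Finset.range L, ∑ y ∈ Finset.range L, if (x, y, a) ∈ P then 1 else 0 := by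
  rw [← Finset.sum_product (s := Finset.range L) (t := Finset.range L)
    (f := fun q : ℕ × ℕ => if ((q.1, q.2, a) : Point) ∈ P then 1 else 0), ← Finset.card_filter]
  unfold zMarginal
  refine Finset.card_nbij' (fun p => (p.1, p.2.1)) (fun q => (q.1, q.2, a)) (fun p hp => ?_)
    (fun q hq => ?_) (fun p hp => ?_) (fun q _ => rfl)
  · obtain ⟨hp, h1⟩ := Finset.mem_filter.1 (Finset.mem_coe.1 hp)
    have hb := mem_box.1 (hP hp)
    refine Finset.mem_coe.2 (Finset.mem_filter.2
      ⟨Finset.mem_product.2 ⟨Finset.mem_range.2 hb.1, Finset.mem_range.2 hb.2.1⟩, ?_⟩)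
    rw [← h1]
    exact hp
  · obtain ⟨-, hq⟩ := Finset.mem_filter.1 (Finset.mem_coe.1 hq)
    exact Finset.mem_coe.2 (Finset.mem_filter.2 ⟨hq, rfl⟩)
  · obtain ⟨-, h1⟩ := Finset.mem_filter.1 (Finset.mem_coe.1 hp)
    exact Prod.ext rfl (Prod.ext rfl h1.symm)

/-- **`S_a(pyrBelow K r)` as the double sum the machine evaluates**: for `r ≤ L`,
`S_a = Σ_{u<L} Σ_{v<L} ([(a,u,v) ∈ P̄] + [(u,a,v) ∈ P̄] + [(u,v,a) ∈ P̄])`. [folklore] -/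
theorem sumMarginal_pyrBelow_eq_sum_sum {r L : ℕ} (hL : r ≤ L) (a : ℕ) :
    sumMarginal (pyrBelow K r) a = ∑ u ∈ Finset.range L, ∑ v ∈ Finset.range L,
      ((if (a, u, v) ∈ pyrBelow K r then 1 else 0) + (if (u, a, v) ∈ pyrBelow K r then 1 else 0) +
        (if (u, v, a) ∈ pyrBelow K r then 1 else 0)) := by
  have hP : pyrBelow K r ⊆ box L := (pyrBelow_subset_box r).trans (box_mono hL)
  simp only [Finset.sum_add_distrib, sumMarginal, xMarginal_eq_sum_sum hP, yMarginal_eq_sum_sum hP,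
    zMarginal_eq_sum_sum hP]

variable (K)

/-! ### The list-level reduction of Lemma 5 -/

/-- **The test of the reduction** (proof of Lemma 5: "we first assert that `|λ̂|` is divisible by 3 and
that `B(λ̂) = rn` holds for `n = |λ̂|/3`"), for a composition `λ̂ = [λ̂_0, …, λ̂_r]` (so `r = |list| - 1`;
the empty list, which is no instance, fails the test): `λ̂ ≠ []`, `3 ∣ |λ̂|`, `3·B(λ̂) = r·|λ̂|`.
[cite: FischerIkenmeyer2020, Lemma 5 (proof)] -/
def Good (l : List ℕ) : Prop := l ≠ [] ∧ 3 ∣ l.sum ∧ 3 * coordSumList l = (l.length - 1) * l.sum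

/-- The test is decidable. [folklore] -/
instance Good.decidable (l : List ℕ) : Decidable (Good l) := inferInstanceAs (Decidable (_ ∧ _ ∧ _))

/-- **Lemma 7's instance** `λ := S(P̄_{r-1}) + λ̂` (pointwise, as a composition of the same length
`r + 1`). [cite: FischerIkenmeyer2020, Lemma 7] -/
def addPyr (l : List ℕ) : List ℕ :=
  (List.range l.length).map fun i => sumMarginal (pyrBelow K (l.length - 1)) i + listFn l i

/-- The trivial no-instance `[1]` ("output a trivially zero Symmetric instance"): `|λ| = 1` is not a
multiple of `3`, so it violates the promise of both promise problems. [cite: FischerIkenmeyer2020, Lemma 5 (proof)] -/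
def badList : List ℕ := [1]

/-- **The reduction of Lemma 5 on compositions**: `λ̂ ↦ S(P̄_{r-1}) + λ̂` if the test passes, else the
trivial no-instance. [cite: FischerIkenmeyer2020, Lemma 5 (proof)] -/
def reduceList (l : List ℕ) : List ℕ := if Good l then addPyr K l else badList

/-- `addPyr` keeps the length. [folklore] -/
@[simp] theorem length_addPyr (l : List ℕ) : (addPyr K l).length = l.length := by simp [addPyr]

/-- **Entries of `addPyr`**: `λ_i = S_i(P̄_{r-1}) + λ̂_i` for every `i` (both sides vanish beyond `r`).
[cite: FischerIkenmeyer2020, Lemma 7] -/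
theorem listFn_addPyr (l : List ℕ) (i : ℕ) :
    listFn (addPyr K l) i = sumMarginal (pyrBelow K (l.length - 1)) i + listFn l i := by
  by_cases hi : i < l.length
  · rw [listFn, addPyr, List.getD_eq_getElem?_getD, List.getElem?_map, List.getElem?_range hi]
    rfl
  · push Not at hi
    rw [listFn_of_le (by simpa using hi), listFn_of_le hi, Nat.add_zero]
    exact (sumMarginal_eq_zero_of_subset_box (pyrBelow_subset_box _) (by omega)).symm

/-- `addPyr` as a function: `listFn (addPyr K l) = S(pyrBelow K r) + listFn l`. [cite: FischerIkenmeyer2020, Lemma 7] -/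
theorem listFn_addPyr_eq (l : List ℕ) :
    listFn (addPyr K l) = sumMarginal (pyrBelow K (l.length - 1)) + listFn l :=
  funext (listFn_addPyr K l)

/-! ### The yes-instance sets for a region `K` -/

/-- Yes-instances of (SKEW-)SYMMETRIC-2D-X-RAY for the region `K`: `λ ∈ ℕ^{[0,r]}` with some
`P ⊆ G_r ∩ K`, `S(P) = λ`. [cite: FischerIkenmeyer2020, §6 (Problem 7)] -/
def symSetK : Set (List ℕ) :=
  {l | ∃ r : ℕ, l.length = r + 1 ∧ ∃ P : Finset Point,
    (∀ p ∈ P, K p ∧ coordSum p = r) ∧ sumMarginal P = listFn l}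

/-- The promise of PROMISE-(SKEW-)SYMMETRIC-3D-X-RAY for `K`: `|λ| = 3n` and `B(λ) = β_K(n)`.
[cite: FischerIkenmeyer2020, §6 (Problem 10)] -/
def PromiseK (l : List ℕ) : Prop := ∃ n : ℕ, l.sum = 3 * n ∧ coordSumList l = betaK K n

/-- Yes-instances of PROMISE-(SKEW-)SYMMETRIC-3D-X-RAY for `K` satisfying the promise.
[cite: FischerIkenmeyer2020, §6 (Problem 10)] -/
def promiseSetK : Set (List ℕ) :=
  {l | PromiseK K l ∧ ∃ P : Finset Point, (∀ p ∈ P, K p) ∧ sumMarginal P = listFn l}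

/-- `symTwoDXRaySet` is the case `K = C̄` (definitionally). [cite: FischerIkenmeyer2020, §6 (Problem 7)] -/
theorem symTwoDXRaySet_eq : symTwoDXRaySet = symSetK IsInClosedCone := rfl

/-- `skewSymTwoDXRaySet` is the case `K = C` (definitionally). [cite: FischerIkenmeyer2020, §6 (Problem 7)] -/
theorem skewSymTwoDXRaySet_eq : skewSymTwoDXRaySet = symSetK IsInOpenCone := rfl

/-- `promiseSymThreeDXRaySet` is the case `K = C̄` (definitionally). [cite: FischerIkenmeyer2020, §6 (Problem 10)] -/
theorem promiseSymThreeDXRaySet_eq : promiseSymThreeDXRaySet = promiseSetK IsInClosedCone := rfl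

/-- `promiseSkewSymThreeDXRaySet` is the case `K = C` (definitionally). [cite: FischerIkenmeyer2020, §6 (Problem 10)] -/
theorem promiseSkewSymThreeDXRaySet_eq : promiseSkewSymThreeDXRaySet = promiseSetK IsInOpenCone := rfl

/-- The trivial no-instance is in neither promise set. [cite: FischerIkenmeyer2020, Lemma 5 (proof)] -/
theorem badList_not_mem_promiseSetK : badList ∉ promiseSetK K := by
  rintro ⟨⟨n, hn, -⟩, -⟩
  simp [badList] at hn
  omega

variable {K}

omit [DecidablePred K] in
/-- **A yes-instance passes the test**: if `P̂ ⊆ G_r ∩ K` has `S(P̂) = λ̂` then `|λ̂| = 3|P̂|` and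
`B(λ̂) = r|P̂|`. [cite: FischerIkenmeyer2020, Lemma 7 ("λ̂ is not trivially rejected")] -/
theorem sum_and_coordSumList_of_solution {l : List ℕ} {r : ℕ} (hl : l.length = r + 1) {P : Finset Point}
    (hP : ∀ p ∈ P, K p ∧ coordSum p = r) (hS : sumMarginal P = listFn l) :
    l.sum = 3 * P.card ∧ coordSumList l = r * P.card := by
  have hbox : P ⊆ box (r + 1) := hl ▸ subset_box_of_sumMarginal_eq hS
  refine ⟨?_, ?_⟩
  · rw [sum_eq_sum_range_listFn, hl, ← hS, sum_sumMarginal hbox]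
  · rw [coordSumList, hl, ← hS, sum_mul_sumMarginal hbox, coordSumSet,
      Finset.sum_const_nat fun p hp => (hP p hp).2, Nat.mul_comm]

omit [DecidablePred K] in
/-- A yes-instance passes the test `Good`. [cite: FischerIkenmeyer2020, Lemma 5 (proof)] -/
theorem good_of_mem_symSetK {l : List ℕ} (h : l ∈ symSetK K) : Good l := by
  obtain ⟨r, hl, P, hP, hS⟩ := h
  obtain ⟨hsum, hB⟩ := sum_and_coordSumList_of_solution hl hP hS
  refine ⟨fun h0 => by simp [h0] at hl, ⟨P.card, hsum⟩, ?_⟩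
  rw [hB, hl, hsum, Nat.add_sub_cancel]
  ring

variable (K)

/-- **Lemma 7, direction "2D solution ↦ 3D solution"**: if `λ̂ ∈ ℕ^{[0,r]}` has a solution
`P̂ ⊆ G_r ∩ K`, then `λ := S(pyrBelow K r) + λ̂` satisfies the promise (`|λ| = 3N`, `B(λ) = β_K(N)`,
`N = |pyrBelow K r| + |P̂|`, using `|P̂| ≤ ξ_K(r)`) and `P := pyrBelow K r ∪ P̂ ⊆ K` has `S(P) = λ`.
[cite: FischerIkenmeyer2020, Lemma 7] -/
theorem addPyr_mem_promiseSetK {l : List ℕ} (h : l ∈ symSetK K) : addPyr K l ∈ promiseSetK K := by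
  obtain ⟨r, hl, P, hP, hS⟩ := h
  obtain ⟨hsum, hB⟩ := sum_and_coordSumList_of_solution hl hP hS
  have hr : l.length - 1 = r := by omega
  have hlayer : P ⊆ layer K r := fun p hp => mem_layer.2 (hP p hp)
  have hdisj : Disjoint (pyrBelow K r) P :=
    Finset.disjoint_of_subset_right hlayer (disjoint_pyrBelow_layer K r)
  have hboxQ : pyrBelow K r ⊆ box (r + 1) := (pyrBelow_subset_box r).trans (box_mono (Nat.le_succ r))
  have hfn : listFn (addPyr K l) = sumMarginal (pyrBelow K r ∪ P) := by
    rw [listFn_addPyr_eq, hr, sumMarginal_union hdisj, hS]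
  refine ⟨⟨(pyrBelow K r).card + P.card, ?_, ?_⟩, pyrBelow K r ∪ P, fun p hp => ?_, hfn.symm⟩
  · -- `|λ| = 3 (|P̄| + |P̂|)`
    rw [sum_eq_sum_range_listFn, length_addPyr, hl, listFn_addPyr_eq, hr]
    simp only [Pi.add_apply, Finset.sum_add_distrib]
    rw [sum_sumMarginal hboxQ, ← hl, ← sum_eq_sum_range_listFn, hsum]
    ring
  · -- `B(λ) = B(P̄) + r |P̂| = β (|P̄| + |P̂|)`
    rw [betaK_card_pyrBelow_add K ((Finset.card_le_card hlayer).trans_eq rfl), coordSumList,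
      length_addPyr, hl, listFn_addPyr_eq, hr]
    simp only [Pi.add_apply, Nat.mul_add, Finset.sum_add_distrib]
    rw [sum_mul_sumMarginal hboxQ, ← hl, ← coordSumList, hB]
  · rcases Finset.mem_union.1 hp with hp | hp
    · exact (mem_pyrBelow.1 hp).1
    · exact (hP p hp).1

/-- **Direction "3D solution ↦ 2D solution"** (the role of Lemma 6 in the proof of Lemma 7, here by a
direct exchange count): if `λ̂` passes the test and some `P ⊆ K` has `S(P) = S(pyrBelow K r) + λ̂`,
then `pyrBelow K r ⊆ P`, `P ∖ pyrBelow K r ⊆ G_r`, and `P̂ := P ∖ pyrBelow K r` solves `λ̂`.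
[cite: FischerIkenmeyer2020, Lemmas 6–7] -/
theorem mem_of_addPyr_mem {l : List ℕ} (hg : Good l)
    (h : ∃ P : Finset Point, (∀ p ∈ P, K p) ∧ sumMarginal P = listFn (addPyr K l)) : l ∈ symSetK K := by
  obtain ⟨P, hK, hS⟩ := h
  obtain ⟨hne, ⟨n, hn⟩, hB⟩ := hg
  set r := l.length - 1 with hr
  have hl : l.length = r + 1 := by
    have : l.length ≠ 0 := fun h0 => hne (List.length_eq_zero_iff.1 h0)
    omega
  -- `B(λ̂) = r n`
  have hBl : coordSumList l = r * n := by
    rw [hn] at hB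
    exact Nat.eq_of_mul_eq_mul_left (by norm_num : 0 < 3) (by rw [hB]; ring)
  set Q := pyrBelow K r with hQ
  have hSi : ∀ i, sumMarginal P i = sumMarginal Q i + listFn l i := fun i => by
    rw [hS, listFn_addPyr]
  have hboxP : P ⊆ box (r + 1) := by
    have := subset_box_of_sumMarginal_eq hS
    rwa [length_addPyr, hl] at this
  have hboxQ : Q ⊆ box (r + 1) := (pyrBelow_subset_box r).trans (box_mono (Nat.le_succ r))
  -- cardinality and coordinate sum of `P`
  have hcardP : P.card = Q.card + n := by
    have h3 : 3 * P.card = 3 * Q.card + 3 * n := by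
      rw [← sum_sumMarginal hboxP, ← sum_sumMarginal hboxQ, ← hn, sum_eq_sum_range_listFn, hl,
        ← Finset.sum_add_distrib]
      exact Finset.sum_congr rfl fun i _ => hSi i
    omega
  have hBP : coordSumSet P = coordSumSet Q + r * n := by
    rw [← sum_mul_sumMarginal hboxP, ← sum_mul_sumMarginal hboxQ, ← hBl, coordSumList, hl,
      ← Finset.sum_add_distrib]
    exact Finset.sum_congr rfl fun i _ => by rw [hSi i, Nat.mul_add]
  -- the exchange count: `D := P ∖ Q`, `M := Q ∖ P`, `I := P ∩ Q`
  set D := P \ Q with hD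
  set M := Q \ P with hM
  have hPsplit : D ∪ P ∩ Q = P := Finset.sdiff_union_inter P Q
  have hQsplit : M ∪ P ∩ Q = Q := by rw [Finset.inter_comm]; exact Finset.sdiff_union_inter Q P
  have hPdisj : Disjoint D (P ∩ Q) := Finset.disjoint_sdiff_inter P Q
  have hQdisj : Disjoint M (P ∩ Q) := by rw [Finset.inter_comm]; exact Finset.disjoint_sdiff_inter Q P
  have hcard1 : D.card + (P ∩ Q).card = P.card := by
    rw [← Finset.card_union_of_disjoint hPdisj, hPsplit]
  have hcard2 : M.card + (P ∩ Q).card = Q.card := by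
    rw [← Finset.card_union_of_disjoint hQdisj, hQsplit]
  have hB1 : coordSumSet D + coordSumSet (P ∩ Q) = coordSumSet P := by
    rw [coordSumSet, coordSumSet, coordSumSet, ← Finset.sum_union hPdisj, hPsplit]
  have hB2 : coordSumSet M + coordSumSet (P ∩ Q) = coordSumSet Q := by
    rw [coordSumSet, coordSumSet, coordSumSet, ← Finset.sum_union hQdisj, hQsplit]
  have hDge : ∀ p ∈ D, r ≤ coordSum p := fun p hp => by
    obtain ⟨hpP, hpQ⟩ := Finset.mem_sdiff.1 hp
    by_contra hlt
    exact hpQ (mem_pyrBelow.2 ⟨hK p hpP, by omega⟩)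
  have hMlt : ∀ p ∈ M, coordSum p + 1 ≤ r := fun p hp =>
    (mem_pyrBelow.1 (Finset.mem_sdiff.1 hp).1).2
  have hbD : D.card * r ≤ coordSumSet D := by
    have := Finset.card_nsmul_le_sum D coordSum r hDge
    rwa [smul_eq_mul] at this
  have hbM : coordSumSet M + M.card ≤ M.card * r := by
    have := Finset.sum_le_card_nsmul M (fun p => coordSum p + 1) r hMlt
    rwa [Finset.sum_add_distrib, Finset.sum_const, smul_eq_mul, smul_eq_mul, Nat.mul_one] at this
  have hcardD : D.card = M.card + n := by omega
  have hMempty : M.card = 0 := by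
    have e : D.card * r = M.card * r + n * r := by rw [hcardD, Nat.add_mul]
    have e' : r * n = n * r := Nat.mul_comm r n
    omega
  have hM0 : M = ∅ := Finset.card_eq_zero.1 hMempty
  have hQP : Q ⊆ P := Finset.sdiff_eq_empty_iff_subset.1 hM0
  have hBD : coordSumSet D = D.card * r := by
    have e : coordSumSet M = 0 := by rw [hM0]; rfl
    have e2 : D.card * r = M.card * r + n * r := by rw [hcardD, Nat.add_mul]
    have e' : r * n = n * r := Nat.mul_comm r n
    omega
  -- every point of `D` lies on `G_r`
  have hDeq : ∀ p ∈ D, coordSum p = r := by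
    have hsub : ∑ p ∈ D, (coordSum p - r) = 0 := by
      rw [Finset.sum_tsub_distrib D hDge, Finset.sum_const, smul_eq_mul, ← coordSumSet, hBD, Nat.sub_self]
    intro p hp
    have h0 := Finset.sum_eq_zero_iff.1 hsub p hp
    have h1 := hDge p hp
    omega
  -- `P̂ := D`
  refine ⟨r, hl, D, fun p hp => ⟨hK p (Finset.mem_sdiff.1 hp).1, hDeq p hp⟩, funext fun i => ?_⟩
  have hPsplit' : D ∪ Q = P := Finset.sdiff_union_of_subset hQP
  have hdisj' : Disjoint D Q := Finset.sdiff_disjoint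
  have := hSi i
  rw [← hPsplit', sumMarginal_union hdisj', Pi.add_apply] at this
  omega

/-- **The list-level reduction is correct** (Lemma 5 on compositions, both cones at once):
`λ̂` is a yes-instance of (SKEW-)SYMMETRIC-2D-X-RAY iff `reduceList K λ̂` is a yes-instance of
PROMISE-(SKEW-)SYMMETRIC-3D-X-RAY satisfying the promise. [cite: FischerIkenmeyer2020, Lemma 5 (with Lemmas 6, 7)] -/
theorem mem_symSetK_iff_reduceList_mem (l : List ℕ) : l ∈ symSetK K ↔ reduceList K l ∈ promiseSetK K := by
  constructor
  · intro h
    rw [reduceList, if_pos (good_of_mem_symSetK h)]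
    exact addPyr_mem_promiseSetK K h
  · intro h
    by_cases hg : Good l
    · rw [reduceList, if_pos hg] at h
      exact mem_of_addPyr_mem K hg h.2
    · rw [reduceList, if_neg hg] at h
      exact absurd h (badList_not_mem_promiseSetK K)

/-- The closed-cone instance: SYMMETRIC-2D-X-RAY versus PROMISE-SYMMETRIC-3D-X-RAY.
[cite: FischerIkenmeyer2020, Lemma 5] -/
theorem mem_symTwoDXRaySet_iff (l : List ℕ) :
    l ∈ symTwoDXRaySet ↔ reduceList IsInClosedCone l ∈ promiseSymThreeDXRaySet :=
  mem_symSetK_iff_reduceList_mem IsInClosedCone l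

/-- The open-cone instance: SKEW-SYMMETRIC-2D-X-RAY versus PROMISE-SKEW-SYMMETRIC-3D-X-RAY.
[cite: FischerIkenmeyer2020, Lemma 5] -/
theorem mem_skewSymTwoDXRaySet_iff (l : List ℕ) :
    l ∈ skewSymTwoDXRaySet ↔ reduceList IsInOpenCone l ∈ promiseSkewSymThreeDXRaySet :=
  mem_symSetK_iff_reduceList_mem IsInOpenCone l

end Tomography

end Literature.Computability.Complexity
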